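import Mathlib
import Summits.PneNP.PneNP.Theorems.OverlapGapAlgebraSearchHardWindowScanWalk

/-!
# Route OverlapGapAlgebra, crux `SearchHardWindow` (stmt-PneNP-2460): the step inequality and the
# induction of the scan correlation inequality (part 2)

Continuation of `…ScanWalk.lean` (same abstract setting: symbols `S`, coordinates `J`, schedule `σ`,
resampling walk `pos`, good set `InG`, stability relation `St`). With `G = {InG}`, `N = |S|`,
`d_j(v) = #{s : v[j↦s] ∈ G}`, `u_j(v) = #{s : v[j↦s] ∈ G, ¬St(v, v[j↦s])}` and the defect
`Λ(j) = Σ_{v∈G} (u_j(v)+1)/d_j(v) · log(u_j(v)+1)`: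

* `scc_step_ineq` — one step of the geometric-mean potential:
  `Σ_{v∈G} log q' + Σ_{v∈G} log d_j − #G log N − Λ(j) ≤ Σ_{v∈G} log q` whenever
  `q(v) = N⁻¹ Σ_{s : v[j↦s] ∈ G, stable} q'(v[j↦s])` on `G`;
* `scc_main` — the induction over the length of the walk:
  `Σ_t [Σ_{v∈G} log d_{σ t} − #G log N − Λ(σ t)] ≤ Σ_{v∈G} log (#{U good-and-stable from v}/N^T)`;
* `scc_sum_inv_d_le`, `scc_sum_log_d_ge` — the fibre sums `N Σ_{v∈G} 1/d_j ≤ #V` and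
  `Σ_{v∈G} log d_j ≥ #G log(#G N/#V)` (Jensen).
No definitions.
-/

set_option linter.dupNamespace false -- `Summit.PneNP.PneNP.…`: summit = sub-problem (D-0017)

namespace Summit.PneNP.PneNP.Theorems

open Finset
open scoped Classical

section ScanCorrelation

variable {S J : Type*} [DecidableEq J]

/-- **The step inequality.** If on good points `q(v) = N⁻¹ Σ_{s : v[j↦s] good, stable} q'(v[j↦s])`
with `q' > 0` on good points, then
`Σ_{v∈G} log q' + Σ_{v∈G} log d_j − #G·log N − Λ_j ≤ Σ_{v∈G} log q`. -/
theorem scc_step_ineq [Fintype S] [Fintype J] [DecidableEq S] (j : J)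
    (InG : (J → S) → Prop) (St : (J → S) → (J → S) → Prop)
    (hsymm : ∀ v w, St v w → St w v) (hrefl : ∀ v, St v v)
    (d u : (J → S) → ℕ)
    (hd : ∀ v, d v = ((univ : Finset S).filter fun s => InG (Function.update v j s)).card)
    (hu : ∀ v, u v = ((univ : Finset S).filter fun s =>
      InG (Function.update v j s) ∧ ¬ St v (Function.update v j s)).card)
    (q q' : (J → S) → ℝ) (hq' : ∀ w, InG w → 0 < q' w)
    (hq : ∀ v, InG v → q v = (Fintype.card S : ℝ)⁻¹ *
      ∑ s, if InG (Function.update v j s) ∧ St v (Function.update v j s)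
        then q' (Function.update v j s) else 0) :
    (∀ v, InG v → 0 < q v) ∧
    ∑ v ∈ univ.filter InG, Real.log (q' v) + ∑ v ∈ univ.filter InG, Real.log (d v) -
        ((univ : Finset (J → S)).filter InG).card * Real.log (Fintype.card S) -
        ∑ v ∈ univ.filter InG, ((u v : ℝ) + 1) / d v * Real.log ((u v : ℝ) + 1)
      ≤ ∑ v ∈ univ.filter InG, Real.log (q v) := by
  have hpt := fun v hv => scc_pointwise j InG St hrefl d u hd hu q q' hq' v hv (hq v hv)
  refine ⟨fun v hv => (hpt v hv).1, ?_⟩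
  have hmem : ∀ v ∈ (univ : Finset (J → S)).filter InG, InG v := fun v hv => by
    simpa only [mem_filter, mem_univ, true_and] using hv
  have hsum := Finset.sum_le_sum fun v hv => (hpt v (hmem v hv)).2
  simp only [Finset.sum_add_distrib, Finset.sum_sub_distrib, Finset.sum_const, nsmul_eq_mul] at hsum
  -- the cross terms
  have hX := scc_exchange j InG St hsymm d hd (fun w => Real.log (q' w))
  rw [hX] at hsum
  -- `(u+1)/d + (#R - 1)/d = 1` on good points
  have hone : ∑ v ∈ univ.filter InG, ((u v : ℝ) + 1) / d v * Real.log (q' v) +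
      ∑ v ∈ univ.filter InG, ((((univ : Finset S).filter fun s =>
        InG (Function.update v j s) ∧ St v (Function.update v j s)).erase (v j)).card : ℝ) *
          (d v : ℝ)⁻¹ * Real.log (q' v) = ∑ v ∈ univ.filter InG, Real.log (q' v) := by
    rw [← Finset.sum_add_distrib]
    refine Finset.sum_congr rfl fun v hv => ?_
    have hv' := hmem v hv
    set R : Finset S := (univ : Finset S).filter fun s =>
      InG (Function.update v j s) ∧ St v (Function.update v j s) with hR
    have hvj : v j ∈ R := by
      simp only [hR, mem_filter, mem_univ, true_and, Function.update_eq_self]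
      exact ⟨hv', hrefl v⟩
    have hRu : (R.card : ℝ) + u v = d v := by
      have h := Finset.card_filter_add_card_filter_not
        (s := (univ : Finset S).filter fun s => InG (Function.update v j s))
        (fun s => St v (Function.update v j s))
      rw [Finset.filter_filter, Finset.filter_filter] at h
      rw [hd, hu, hR]
      exact_mod_cast h
    have hcardE : ((R.erase (v j)).card : ℝ) = R.card - 1 := by
      rw [Finset.card_erase_of_mem hvj, Nat.cast_sub (Finset.card_pos.2 ⟨v j, hvj⟩), Nat.cast_one]
    have hd0 : (0 : ℝ) < d v := by
      have hR1 : (1 : ℝ) ≤ R.card := by exact_mod_cast Finset.card_pos.2 ⟨v j, hvj⟩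
      have hu0 : (0 : ℝ) ≤ u v := Nat.cast_nonneg _
      linarith
    rw [hcardE]
    have key : ((u v : ℝ) + 1) / d v + ((R.card : ℝ) - 1) * (d v : ℝ)⁻¹ = 1 := by
      field_simp
      linarith
    calc ((u v : ℝ) + 1) / d v * Real.log (q' v) + ((R.card : ℝ) - 1) * (d v : ℝ)⁻¹ * Real.log (q' v)
        = (((u v : ℝ) + 1) / d v + ((R.card : ℝ) - 1) * (d v : ℝ)⁻¹) * Real.log (q' v) := by ring
      _ = Real.log (q' v) := by rw [key, one_mul]
  linarith [hsum, hone]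

/-! ### The induction over the length of the walk -/

/-- The potential bound, by induction on `T` (schedule and position function universally
quantified, as the remaining walk is read off the same `pos` one step later):
`Σ_t [Σ_{v∈G} log d_{σ t} − #G log N − Λ_{σ t}] ≤ Σ_{v∈G} log (#{U good-and-stable from v}/N^T)`. -/
theorem scc_main [Fintype S] [Fintype J] [DecidableEq S]
    (InG : (J → S) → Prop) (St : (J → S) → (J → S) → Prop)
    (hsymm : ∀ v w, St v w → St w v) (hrefl : ∀ v, St v v)
    (d u : J → (J → S) → ℕ)
    (hd : ∀ j v, d j v = ((univ : Finset S).filter fun s => InG (Function.update v j s)).card)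
    (hu : ∀ j v, u j v = ((univ : Finset S).filter fun s =>
      InG (Function.update v j s) ∧ ¬ St v (Function.update v j s)).card) :
    ∀ (T : ℕ) (σ : Fin T → J) (pos : (J → S) → (Fin T → S) → ℕ → (J → S)),
      (∀ v U, pos v U 0 = v) →
      (∀ v U (t : Fin T), pos v U ((t : ℕ) + 1) = Function.update (pos v U t) (σ t) (U t)) →
      ∑ t : Fin T, (∑ v ∈ univ.filter InG, Real.log (d (σ t) v) -
          ((univ : Finset (J → S)).filter InG).card * Real.log (Fintype.card S) -
          ∑ v ∈ univ.filter InG, ((u (σ t) v : ℝ) + 1) / d (σ t) v * Real.log ((u (σ t) v : ℝ) + 1))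
        ≤ ∑ v ∈ univ.filter InG, Real.log ((((univ : Finset (Fin T → S)).filter fun U =>
            (∀ t : Fin (T + 1), InG (pos v U t)) ∧
              ∀ t : Fin T, St (pos v U t) (pos v U ((t : ℕ) + 1))).card : ℝ) /
            (Fintype.card S : ℝ) ^ T) := by
  intro T
  induction T with
  | zero =>
    intro σ pos hpos0 _
    rw [Fin.sum_univ_zero]
    refine Finset.sum_nonneg fun v hv => ?_
    have hv' : InG v := by simpa only [mem_filter, mem_univ, true_and] using hv
    have hall : ((univ : Finset (Fin 0 → S)).filter fun U =>
        (∀ t : Fin (0 + 1), InG (pos v U t)) ∧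
          ∀ t : Fin 0, St (pos v U t) (pos v U ((t : ℕ) + 1))) = univ := by
      refine Finset.filter_true_of_mem fun U _ => ⟨fun t => ?_, fun t => t.elim0⟩
      rw [Fin.val_eq_zero t, hpos0]; exact hv'
    rw [hall, Finset.card_univ, pow_zero, div_one]
    simp
  | succ T ih =>
    intro σ pos hpos0 hposS
    set N : ℝ := (Fintype.card S : ℝ) with hN
    -- the remaining walk: directions `σ ∘ succ`, positions read off `pos` one step later
    obtain ⟨pos', hpos'⟩ : ∃ pos' : (J → S) → (Fin T → S) → ℕ → (J → S),
        ∀ w U' t, pos' w U' t = pos w (Fin.cons (w (σ 0)) U') (t + 1) := ⟨_, fun _ _ _ => rfl⟩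
    have hpos0' : ∀ w U', pos' w U' 0 = w := fun w U' => by
      rw [hpos']
      simpa only [Fin.val_zero, zero_add, hpos0, Fin.cons_zero, Function.update_eq_self] using
        hposS w (Fin.cons (w (σ 0)) U') 0
    have hposS' : ∀ w U' (t : Fin T), pos' w U' ((t : ℕ) + 1) =
        Function.update (pos' w U' t) (σ t.succ) (U' t) := fun w U' t => by
      rw [hpos', hpos']
      simpa only [Fin.val_succ, Fin.cons_succ] using hposS w (Fin.cons (w (σ 0)) U') t.succ
    have hIH := ih (fun t => σ t.succ) pos' hpos0' hposS'
    -- the fractions `q` (length `T+1`) and `q'` (length `T`, remaining walk)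
    set q' : (J → S) → ℝ := fun w => (((univ : Finset (Fin T → S)).filter fun U' =>
      (∀ t : Fin (T + 1), InG (pos' w U' t)) ∧
        ∀ t : Fin T, St (pos' w U' t) (pos' w U' ((t : ℕ) + 1))).card : ℝ) / N ^ T with hq'def
    set q : (J → S) → ℝ := fun v => (((univ : Finset (Fin (T + 1) → S)).filter fun U =>
      (∀ t : Fin (T + 1 + 1), InG (pos v U t)) ∧
        ∀ t : Fin (T + 1), St (pos v U t) (pos v U ((t : ℕ) + 1))).card : ℝ) / N ^ (T + 1)
      with hqdef
    have hN0 : ∀ w, InG w → (0 : ℝ) < N := fun w _ => by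
      rw [hN]; exact_mod_cast Fintype.card_pos_iff.2 ⟨w (σ 0)⟩
    have hq'pos : ∀ w, InG w → 0 < q' w := fun w hw => by
      simp only [hq'def]
      have hc := scc_card_pos T (fun t => σ t.succ) InG St hrefl pos' hpos0' hposS' w hw
      exact div_pos (by exact_mod_cast hc) (pow_pos (hN0 w hw) T)
    -- the one-step decomposition of `q` on good points
    have hq : ∀ v, InG v → q v = N⁻¹ * ∑ s, if InG (Function.update v (σ 0) s) ∧
        St v (Function.update v (σ 0) s) then q' (Function.update v (σ 0) s) else 0 := by
      intro v hv
      have hdec := scc_card_decomp T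
        (fun U => (∀ t : Fin (T + 1 + 1), InG (pos v U t)) ∧
          ∀ t : Fin (T + 1), St (pos v U t) (pos v U ((t : ℕ) + 1)))
        (fun s => InG v ∧ St v (Function.update v (σ 0) s))
        (fun s U' => (∀ t : Fin (T + 1), InG (pos' (Function.update v (σ 0) s) U' t)) ∧
          ∀ t : Fin T, St (pos' (Function.update v (σ 0) s) U' t)
            (pos' (Function.update v (σ 0) s) U' ((t : ℕ) + 1)))
        (fun s U' => by
          rw [scc_decomp T σ InG St pos hpos0 hposS v s U']
          simp only [hpos', Function.update_self])
      simp only [hqdef, hq'def]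
      rw [hdec, pow_succ, Finset.mul_sum, Finset.sum_div]
      refine Finset.sum_congr rfl fun s _ => ?_
      have hNne : N ≠ 0 := (hN0 v hv).ne'
      by_cases hs : InG (Function.update v (σ 0) s)
      · simp only [hv, hs, true_and]
        split_ifs
        · field_simp
        · simp
      · have h0 := scc_card_zero T InG St pos' hpos0' _ hs
        simp only [hs, false_and, if_false]
        split_ifs
        · rw [h0]; simp
        · simp
    -- the analytic step and the induction hypothesis
    have hstep := (scc_step_ineq (σ 0) InG St hsymm hrefl (d (σ 0)) (u (σ 0)) (hd (σ 0))
      (hu (σ 0)) q q' hq'pos hq).2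
    rw [Fin.sum_univ_succ]
    simp only [hq'def, hqdef] at hstep hIH ⊢
    linarith [hstep, hIH]

/-! ### Fibre sums: `Σ_{v∈G} 1/d ≤ #V/N` and `Σ_{v∈G} log d ≥ #G log(#G N/#V)` -/

/-- Each fibre meeting `G` contributes `d · (1/d) = 1`: `N · Σ_{v ∈ G} d_j(v)⁻¹ ≤ #V`. -/
theorem scc_sum_inv_d_le [Fintype S] [Fintype J] [DecidableEq S] (j : J)
    (InG : (J → S) → Prop) (d : (J → S) → ℕ)
    (hd : ∀ v, d v = ((univ : Finset S).filter fun s => InG (Function.update v j s)).card) :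
    (Fintype.card S : ℝ) * ∑ v ∈ univ.filter InG, (d v : ℝ)⁻¹ ≤ Fintype.card (J → S) := by
  -- as a sum over pairs `(v, s)`, reflected by the involution
  set e : (J → S) × S ≃ (J → S) × S := Function.Involutive.toPerm _ (scc_invol (S := S) j) with he
  have h1 : (Fintype.card S : ℝ) * ∑ v ∈ univ.filter InG, (d v : ℝ)⁻¹ =
      ∑ p : (J → S) × S, if InG p.1 then (d p.1 : ℝ)⁻¹ else 0 := by
    rw [Fintype.sum_prod_type, Finset.sum_filter, Finset.mul_sum]
    refine Finset.sum_congr rfl fun v _ => ?_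
    rw [Finset.sum_eq_card_nsmul (b := if InG v then ((d v : ℕ) : ℝ)⁻¹ else 0) (fun y _ => rfl),
      Finset.card_univ, nsmul_eq_mul]
  have h2 : ∑ p : (J → S) × S, (if InG p.1 then (d p.1 : ℝ)⁻¹ else 0) =
      ∑ p : (J → S) × S, (if InG (Function.update p.1 j p.2) then (d p.1 : ℝ)⁻¹ else 0) := by
    rw [← Equiv.sum_comp e]
    refine Finset.sum_congr rfl fun p _ => ?_
    simp only [he, Function.Involutive.coe_toPerm, scc_d_update j InG d hd]
  have h3 : ∑ p : (J → S) × S, (if InG (Function.update p.1 j p.2) then (d p.1 : ℝ)⁻¹ else 0) =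
      ∑ v : J → S, if d v = 0 then (0 : ℝ) else 1 := by
    rw [Fintype.sum_prod_type]
    refine Finset.sum_congr rfl fun v _ => ?_
    dsimp only
    rw [← Finset.sum_filter, Finset.sum_const, nsmul_eq_mul, ← hd v]
    by_cases h0 : d v = 0
    · simp [h0]
    · rw [if_neg h0, mul_inv_cancel₀ (by exact_mod_cast h0)]
  rw [h1, h2, h3]
  calc ∑ v : J → S, (if d v = 0 then (0 : ℝ) else 1) ≤ ∑ _v : J → S, (1 : ℝ) :=
        Finset.sum_le_sum fun v _ => by split_ifs <;> norm_num
    _ = Fintype.card (J → S) := by simp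

/-- Jensen for the fibre sizes: `#G · log(#G · N / #V) ≤ Σ_{v ∈ G} log d_j(v)`. -/
theorem scc_sum_log_d_ge [Fintype S] [Fintype J] [DecidableEq S] (j : J)
    (InG : (J → S) → Prop) (d : (J → S) → ℕ)
    (hd : ∀ v, d v = ((univ : Finset S).filter fun s => InG (Function.update v j s)).card)
    (hG : 0 < ((univ : Finset (J → S)).filter InG).card) :
    (((univ : Finset (J → S)).filter InG).card : ℝ) *
        Real.log (((univ : Finset (J → S)).filter InG).card * Fintype.card S / Fintype.card (J → S))
      ≤ ∑ v ∈ univ.filter InG, Real.log (d v) := by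
  set G : Finset (J → S) := univ.filter InG with hGdef
  have hGpos : (0 : ℝ) < G.card := by exact_mod_cast hG
  have hmem : ∀ v ∈ G, InG v := fun v hv => by
    simpa only [hGdef, mem_filter, mem_univ, true_and] using hv
  have hdpos : ∀ v ∈ G, (0 : ℝ) < d v := fun v hv => by
    rw [hd]
    exact_mod_cast Finset.card_pos.2 ⟨v j, by
      simp only [mem_filter, mem_univ, true_and, Function.update_eq_self]; exact hmem v hv⟩
  obtain ⟨v₀, hv₀⟩ := Finset.card_pos.1 hG
  have hN0 : (0 : ℝ) < Fintype.card S := by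
    exact_mod_cast Fintype.card_pos_iff.2 ⟨v₀ j⟩
  have hV0 : (0 : ℝ) < Fintype.card (J → S) := by
    exact_mod_cast Fintype.card_pos_iff.2 ⟨v₀⟩
  -- Jensen: `avg log (1/d) ≤ log avg (1/d)`
  have hJ : ∑ v ∈ G, (G.card : ℝ)⁻¹ • Real.log ((d v : ℝ)⁻¹) ≤
      Real.log (∑ v ∈ G, (G.card : ℝ)⁻¹ • (d v : ℝ)⁻¹) := by
    refine (strictConcaveOn_log_Ioi.concaveOn).le_map_sum (fun _ _ => (inv_pos.2 hGpos).le) ?_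
      (fun v hv => inv_pos.2 (hdpos v hv))
    rw [Finset.sum_const, nsmul_eq_mul, mul_inv_cancel₀ hGpos.ne']
  simp only [smul_eq_mul, ← Finset.mul_sum, Real.log_inv, Finset.sum_neg_distrib, mul_neg] at hJ
  -- `avg (1/d) ≤ #V/(N #G)`
  have havg : (G.card : ℝ)⁻¹ * ∑ v ∈ G, (d v : ℝ)⁻¹ ≤
      Fintype.card (J → S) / (Fintype.card S * G.card) := by
    have h := scc_sum_inv_d_le j InG d hd
    rw [← hGdef] at h
    rw [le_div_iff₀ (mul_pos hN0 hGpos)]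
    calc (G.card : ℝ)⁻¹ * (∑ v ∈ G, (d v : ℝ)⁻¹) * (Fintype.card S * G.card)
        = Fintype.card S * ∑ v ∈ G, (d v : ℝ)⁻¹ := by field_simp
      _ ≤ Fintype.card (J → S) := h
  have hpos_avg : 0 < (G.card : ℝ)⁻¹ * ∑ v ∈ G, (d v : ℝ)⁻¹ :=
    mul_pos (inv_pos.2 hGpos) (Finset.sum_pos (fun v hv => inv_pos.2 (hdpos v hv)) ⟨v₀, hv₀⟩)
  have hlog : Real.log ((G.card : ℝ)⁻¹ * ∑ v ∈ G, (d v : ℝ)⁻¹) ≤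
      Real.log (Fintype.card (J → S) / (Fintype.card S * G.card)) :=
    Real.log_le_log hpos_avg havg
  have hlog' : Real.log (Fintype.card (J → S) / (Fintype.card S * G.card)) =
      -Real.log (G.card * Fintype.card S / Fintype.card (J → S)) := by
    rw [← Real.log_inv]
    congr 1
    field_simp
  rw [hlog'] at hlog
  have key : Real.log (G.card * Fintype.card S / Fintype.card (J → S)) ≤
      (G.card : ℝ)⁻¹ * ∑ v ∈ G, Real.log (d v) := by linarith
  have := mul_le_mul_of_nonneg_left key hGpos.le
  rwa [← mul_assoc, mul_inv_cancel₀ hGpos.ne', one_mul] at this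

end ScanCorrelation

end Summit.PneNP.PneNP.Theorems
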